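import Literature.NumberTheory.EllipticCurves.HeegnerPointsKolyvaginPrimaryClassesProofs
import Literature.NumberTheory.EllipticCurves.KummerSelmerStructure
import HarnessLib

/-!
# Level reduction of Kolyvagin's classes: `[k]_* c_{kd}(P) = c_d(P)` (lemma (a) of the DEPTH-ONE first-block argument for K4Neg)

LEAD seat `bsd-line-gk2-p1` g23 (cell `bsd-f1-sign2`), `--supports stmt-BirchSwinnertonDyer-31526 --as helper`.  THEOREMS ONLY; Literature imports only
(route-independent).  **BSD is NOT proved by this; nothing is closed.**

McCallum's cocycle of `P` at level `n = kd`, `g ↦ g(P/n) − P/n − (g−1)P/n` (`KolyvaginCocycle.cocycle`, root `Q`, `nQ = P`), pushed along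
`[k] : E[kd] → E[d]` (the tree's `WeierstrassCurve.torsionMulBy k d`), is McCallum's cocycle of the SAME point `P` at level `d` with root `kQ`:
`k·(gQ − Q) = g(kQ) − kQ` and `k·((g−1)P/(kd)) = (g−1)P/d` (uniqueness of `A`-rational roots).  Hence
`galoisCohomology.map (torsionMulBy k d) 1 (kolyvaginClass W (k*d) … P …) = kolyvaginClass W d … P …` — the Kolyvagin analogue of the tree's
`map_torsionMulBy_kummerClassTorsion` (Milne *ADT* I.6.9's `A_{m²} → A_m`).  Used at `(k, d) = (2, 2)`: the level-`4` class `c₂(ℓ)` reduces to `c₁(ℓ)`,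
so `c₁(ℓ) = 0` puts `c₂(ℓ)` in the image of `H¹(K, E[2]) → H¹(K, E[4])` (tree `exists_map_inclKD_eq_of_map_mulK_eq_zero_global`).
References: [McCallumLMS1991] §4 (4)–(6), Lemma 4.1; [GrossLMS1991] §4 (4.4), (4.6); [MilneADT2006] I.§6 Prop. 6.9 (proof).
-/

set_option autoImplicit false
set_option linter.dupNamespace false -- `Summit.<P>.<Sub>` repeats `BirchSwinnertonDyer` (D-0017)

noncomputable section

open scoped Classical

namespace Summit.BirchSwinnertonDyer.BirchSwinnertonDyer.Theorems.GenusSupplyNarrow.DepthOne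

open WeierstrassCurve Field Literature.NumberTheory.EllipticCurves Literature.NumberTheory.EllipticCurves.KolyvaginCocycle
open Literature.NumberTheory.GaloisRepresentations

universe u

variable {K : Type u} [Field K] (W : WeierstrassCurve K)

/-- **Admissibility descends along a divisor of the level**: `A` admissible for `k*d` ⟹ admissible for `d` (`d•a = 0 ⟹ (k*d)•a = 0`). [folklore] -/
theorem isAdmissible_of_mul {G M : Type*} [Group G] [AddCommGroup M] [DistribMulAction G M] {A : AddSubgroup M} {k d : ℤ}
    (hA : IsAdmissible G A (k * d)) : IsAdmissible G A d where
  smul_mem := hA.smul_mem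
  eq_zero_of_zsmul := fun a ha hda ↦ hA.eq_zero_of_zsmul ha (by rw [mul_zsmul, hda, zsmul_zero])

/-- **Invariance mod `A`-roots descends**: `P ∈ invPoints A (k*d)` ⟹ `P ∈ invPoints A d` (`(g−1)P = (k d)R = d(kR)`). [folklore] -/
theorem mem_invPoints_of_mul {G M : Type*} [Group G] [AddCommGroup M] [DistribMulAction G M] {A : AddSubgroup M} {k d : ℤ} {P : M}
    (hP : P ∈ invPoints G A (k * d)) : P ∈ invPoints G A d := by
  refine ⟨hP.1, fun g ↦ ?_⟩
  obtain ⟨R, hR, hRe⟩ := hP.2 g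
  exact ⟨k • R, A.zsmul_mem hR k, by rw [smul_smul, mul_comm d k, hRe]⟩

/-- **`k · ((g−1)P/(kd)) = (g−1)P/d`**: the `A`-rational `d`-th root of `x ∈ (kd)A` is `k` times its `(kd)`-th root. [folklore] -/
theorem zsmul_rootIn_mul {G M : Type*} [Group G] [AddCommGroup M] [DistribMulAction G M] {A : AddSubgroup M} {k d : ℤ}
    (hA : IsAdmissible G A (k * d)) {P : M} (hP : P ∈ invPoints G A (k * d)) (g : G) :
    k • rootIn A (k * d) (g • P - P) = rootIn A d (g • P - P) := by
  obtain ⟨hmem, hsmul⟩ := rootIn_smul_sub_spec hP g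
  symm
  exact rootIn_eq (isAdmissible_of_mul hA).eq_zero_of_zsmul (A.zsmul_mem hmem k) (by rw [smul_smul, mul_comm d k, hsmul])

/-- **LEVEL REDUCTION `[k]_* c_{kd}(P) = c_d(P)`** for Kolyvagin's class of a point `P ∈ E(K̄)` relative to an admissible `A ⊆ E(K̄)` (McCallum's cocycle;
any roots): pushing the level-`kd` class along `[k] : E[kd] → E[d]` gives the level-`d` class of the same point.  Cocycle-level: `k(gQ − Q − (g−1)P/(kd))
= g(kQ) − kQ − (g−1)P/d`.  [cite: McCallumLMS1991, §4 (6), Lemma 4.1] [cite: GrossLMS1991, §4 (4.4)] [cite: MilneADT2006, Ch. I Prop. 6.9 (proof)] -/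
theorem map_torsionMulBy_kolyvaginClass {k d : ℤ}
    {hdiv : ∀ P : geomPoints W, ∃ Q : geomPoints W, (k * d) • Q = P} {hdiv' : ∀ P : geomPoints W, ∃ Q : geomPoints W, d • Q = P}
    {A : AddSubgroup (geomPoints W)} (hA : IsAdmissible (absoluteGaloisGroup K) A (k * d)) {P : geomPoints W}
    (hP : P ∈ invPoints (absoluteGaloisGroup K) A (k * d)) :
    galoisCohomology.map (W.torsionMulBy k d) 1 (kolyvaginClass W (k * d) hdiv hA P hP) =
      kolyvaginClass W d hdiv' (isAdmissible_of_mul hA) P (mem_invPoints_of_mul hP) := by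
  obtain ⟨Q, hQ⟩ := hdiv P
  have hkQ : d • (k • Q) = P := by rw [smul_smul, mul_comm d k, hQ]
  rw [kolyvaginClass_eq_cls hA hP hQ, kolyvaginClass_eq_cls (isAdmissible_of_mul hA) (mem_invPoints_of_mul hP) hkQ]
  unfold KolyvaginCocycle.cls
  refine (galoisCohomology.map_one_oneCocycleClass (W.torsionMulBy k d) (cocycle hA _ hP hQ)).trans ?_
  congr 1
  apply Subtype.ext
  ext σ : 1
  apply Subtype.ext
  change k • (σ • Q - Q - rootIn A (k * d) (σ • P - P)) = σ • (k • Q) - k • Q - rootIn A d (σ • P - P)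
  rw [zsmul_sub, zsmul_sub, smul_zsmul_geomPoints, zsmul_rootIn_mul hA hP]

end Summit.BirchSwinnertonDyer.BirchSwinnertonDyer.Theorems.GenusSupplyNarrow.DepthOne

end
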